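import Literature.Probability.RandomPlanarGeometry.HexSAWStripWidthThreeHatRecursion
import HarnessLib

/-!
# The width-three strip: the INITIAL VALUES of the hat recursion in closed form — `D̂(0) = M̂(0)`, `D̂(1) = G₃(1 + M̂(0))`, `D̂(2) = G₃²(1 + M̂(0))`,
# `D̂(3) = G₃³(1 + M̂(0)) + q(1 + M̂(0))(E₁₅ + E₄₀)(1 + M̂(0))`, `D̂(4) = G₃D̂(3) + qE′D̂(1)` (module «WIDTH-THREE HAT INITIAL»)

Topic `Literature/Probability/RandomPlanarGeometry` (continues «WIDTH-THREE HAT RECURSION» `HexSAWStripWidthThreeHatRecursion.lean` — `W3.hatD_three_rec` (the order-four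
recursion from `k ≥ 1`, i.e. from `D̂(5)` on), `W3.hatM_three_zero/one/two_three_four`, `W3.hatMZeroThree_mul_self`, `W3.gThree_eq`, `W3.eSerpThree`,
`W3.ePrimeThree`; the width-two twins are «WIDTH-TWO HAT CONVERGENCE»'s `W2.hatD_two_zero : D̂(0) = M̂(0)` and `W2.hatD_two_one : D̂(1) = G(1 + M̂(0))`).
Lane «pcv-sawmu» (CriticalPhenomena venture), a-p2 g28 — step 4 of the width-three contact-variance programme.  An order-four recursion valid from `D̂(5)` on
determines every hat bridge sum of `S₃` from the four initial blocks `D̂(1), …, D̂(4)` (the stack `𝕊(1)` of «WIDTH-THREE HAT COMPANION»); this module computes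
them (and `D̂(0)`) in CLOSED FORM from the renewal equation at `k = 0, …, 4`, so that the limit `lim_k D̂(k) = Π·𝕊(1)` of the next cars is an explicit matrix.
The device throughout: `hat_ren` at index `k` reads `(1 − M̂(0))D̂(k) = (known)`, and `(1 − M̂(0))⁻¹ = 1 + M̂(0)` because `M̂(0)² = 0`.  Sources of the SETTING:
W. Feller I (1968) XIII.3 (renewal equation); H. Duminil-Copin, A. Hammond, CMP 324 (2013) §2.2; R. P. Stanley EC1 (2012) §4.1.  Nothing below is printed.

## What is proved (namespace `Literature.Probability.RandomPlanarGeometry.SAW.HV.W3`; `x = x_c`, `q = x⁶y`, `G₃ = gThree y`, `M̂(0) = hatMZeroThree`, `E = eSerpThree`,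
## `E′ = ePrimeThree`; every `0 ≤ y`)

* `eq_one_add_hatMZero_mul` (the solving device: `X = Y + M̂(0)X ⇒ X = (1 + M̂(0))Y`), `one_add_hatMZero_mul_eSerp : (1 + M̂(0))E = E′`.
* ★ `hatD_three_zero : D̂(0) = M̂(0)`; ★ `hatD_three_one : D̂(1) = G₃(1 + M̂(0))`; ★ `hatD_three_two : D̂(2) = G₃·D̂(1)`;
  ★★ `hatD_three_three : D̂(3) = G₃·D̂(2) + q·((1 + M̂(0))E(1 + M̂(0)))` (the first serpentine enters at hat index 3);
  ★★ `hatD_three_four : D̂(4) = G₃·D̂(3) + q·(E′·D̂(1))`; ★ `hatD_three_four_defect : D̂(4) = G₃D̂(3) + q(1+E′)D̂(1) − qG₃D̂(0) − q·G₃` — the order-four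
  recursion of car 1 FAILS at `k = 0` by exactly `−qG₃` (its threshold `k ≥ 1` is sharp), as the exact-arithmetic kit of car 1 found.
* ★ `hatD_three_two_pow : D̂(2) = G₃²(1+M̂(0))`, `hatD_three_three_pow : D̂(3) = G₃³(1+M̂(0)) + q(1+M̂(0))E(1+M̂(0))` — with `hatD_three_one` and `hatD_three_four`
  the stack `𝕊(1) = (D̂(4), D̂(3), D̂(2), D̂(1))` of «WIDTH-THREE HAT COMPANION» is an explicit polynomial matrix in `x`, `y`.

Label: LANE THEOREM (own result of lane «pcv-sawmu», a-p2 g28, 2026-08-28; not in print).  NOT claimed: the limit matrix `lim D̂(k)` itself (needs the spectral gap of the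
companion matrix — numerics kit j300802); the analogous initial values of the contact sums `Ĉ(0…4)`, `Ĉ²(0…4)` (same method via `hat_contact_ren`; next car).
-/

noncomputable section

open Finset Filter Topology Matrix Literature.Probability.LatticeModels Literature.Probability.Percolation

namespace Literature.Probability.RandomPlanarGeometry.SAW

namespace HV

namespace W3

/-! ## §1 The solving device and `(1 + M̂(0))E = E′` -/

/-- The solving device of the width-three hat algebra: if `X = Y + M̂(0)·X` then `X = (1 + M̂(0))·Y` (because `M̂(0)² = 0`, so `1 + M̂(0)` inverts `1 − M̂(0)`).
[cite: Feller1968, XIII.3; lane «pcv-sawmu» a-p2 g28] -/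
theorem eq_one_add_hatMZero_mul {X Y : Matrix (Fin (2 * 3)) (Fin (2 * 3)) ℝ} (h : X = Y + hatMZeroThree * X) : X = (1 + hatMZeroThree) * Y := by
  have hsub : X - hatMZeroThree * X = Y := by rw [sub_eq_iff_eq_add]; exact h
  have key : (1 + hatMZeroThree) * (X - hatMZeroThree * X) = X := by
    rw [Matrix.mul_sub, Matrix.add_mul, Matrix.one_mul, Matrix.add_mul, Matrix.one_mul, ← Matrix.mul_assoc, hatMZeroThree_mul_self, Matrix.zero_mul]
    abel
  rw [← key, hsub]

/-- `(1 + M̂(0))·(E₁₅ + E₄₀) = E′ = E₁₅ + E₄₀ + x·E₅₀`. [cite: Feller1968, XIII.3; lane «pcv-sawmu» a-p2 g28] -/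
theorem one_add_hatMZero_mul_eSerp : (1 + hatMZeroThree) * eSerpThree = ePrimeThree := by
  ext a b
  fin_cases a <;> fin_cases b <;> simp [hatMZeroThree, eSerpThree, ePrimeThree, Matrix.mul_apply, Matrix.add_apply, Fin.sum_univ_succ, Matrix.one_apply]

/-! ## §2 The five initial hat bridge sums of `S₃` -/

/-- ★ `D̂(0) = M̂(0)`: the only bridges of `S₃` with `χ_a − χ_b` steps are the three one-step slants of `M̂(0)`. [cite: Feller1968, XIII.3; DuminilCopinHammond2013, §2.2; lane «pcv-sawmu» a-p2 g28] -/
theorem hatD_three_zero {y : ℝ} (hy : 0 ≤ y) : hatD 3 y 0 = hatMZeroThree := by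
  have hren := hat_ren (T := 3) hy 0
  rw [Finset.Nat.antidiagonal_zero, Finset.sum_singleton, hatM_three_zero] at hren
  rw [eq_one_add_hatMZero_mul hren, Matrix.add_mul, Matrix.one_mul, hatMZeroThree_mul_self, add_zero]

/-- ★ `D̂(1) = G₃·(1 + M̂(0))`. [cite: Feller1968, XIII.3; DuminilCopinHammond2013, §2.2; lane «pcv-sawmu» a-p2 g28] -/
theorem hatD_three_one {y : ℝ} (hy : 0 ≤ y) : hatD 3 y 1 = gThree y * (1 + hatMZeroThree) := by
  have hren := hat_ren (T := 3) hy 1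
  rw [Finset.Nat.sum_antidiagonal_succ, Finset.Nat.antidiagonal_zero, Finset.sum_singleton, hatM_three_zero, hatM_three_one, hatD_three_zero hy] at hren
  simp only [zero_add] at hren
  -- hren : D̂1 = M̂1 + (M̂0·D̂1 + M̂1·M̂0)
  have h : hatD 3 y 1 = hatMOneThree y * (1 + hatMZeroThree) + hatMZeroThree * hatD 3 y 1 := by
    rw [Matrix.mul_add, Matrix.mul_one]
    calc hatD 3 y 1 = hatMOneThree y + (hatMZeroThree * hatD 3 y 1 + hatMOneThree y * hatMZeroThree) := hren
      _ = _ := by abel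
  rw [eq_one_add_hatMZero_mul h, gThree_eq, Matrix.mul_assoc]

/-- ★ `D̂(2) = G₃·D̂(1)` (no irreducible bridge of hat index `2`). [cite: Feller1968, XIII.3; DuminilCopinHammond2013, §2.2; lane «pcv-sawmu» a-p2 g28] -/
theorem hatD_three_two {y : ℝ} (hy : 0 ≤ y) : hatD 3 y 2 = gThree y * hatD 3 y 1 := by
  obtain ⟨hM2, -, -⟩ := hatM_three_two_three_four y
  have hren := hat_ren (T := 3) hy 2
  rw [Finset.Nat.sum_antidiagonal_succ, Finset.Nat.sum_antidiagonal_succ, Finset.Nat.antidiagonal_zero, Finset.sum_singleton, hatM_three_zero,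
    hatM_three_one, hM2] at hren
  simp only [zero_add, Matrix.zero_mul, add_zero, show (1 : ℕ) + 1 = 2 from rfl] at hren
  -- hren : D̂2 = M̂0·D̂2 + M̂1·D̂1
  have h : hatD 3 y 2 = hatMOneThree y * hatD 3 y 1 + hatMZeroThree * hatD 3 y 2 := by
    calc hatD 3 y 2 = hatMZeroThree * hatD 3 y 2 + hatMOneThree y * hatD 3 y 1 := hren
      _ = _ := by abel
  rw [eq_one_add_hatMZero_mul h, gThree_eq, Matrix.mul_assoc]

/-- ★★ `D̂(3) = G₃·D̂(2) + q·((1 + M̂(0))·(E₁₅ + E₄₀)·(1 + M̂(0)))`: at hat index `3` the first serpentines (`serpUp 1`, `serpDn 1`, weight `q = x⁶y`) enter,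
alone and composed with the slants of `M̂(0)` on either side. [cite: Feller1968, XIII.3; DuminilCopinHammond2013, §2.2; lane «pcv-sawmu» a-p2 g28 — own] -/
theorem hatD_three_three {y : ℝ} (hy : 0 ≤ y) :
    hatD 3 y 3 = gThree y * hatD 3 y 2 + (hexCriticalFugacity ^ 6 * y) • ((1 + hatMZeroThree) * eSerpThree * (1 + hatMZeroThree)) := by
  obtain ⟨hM2, hM3, -⟩ := hatM_three_two_three_four y
  have hren := hat_ren (T := 3) hy 3
  rw [Finset.Nat.sum_antidiagonal_succ, Finset.Nat.sum_antidiagonal_succ, Finset.Nat.sum_antidiagonal_succ, Finset.Nat.antidiagonal_zero, Finset.sum_singleton,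
    hatM_three_zero, hatM_three_one, hM2, hM3, hatD_three_zero hy] at hren
  simp only [zero_add, Matrix.zero_mul] at hren
  -- hren : D̂3 = qE + (M̂0·D̂3 + (M̂1·D̂2 + qE·M̂0))
  have h : hatD 3 y 3 = (hatMOneThree y * hatD 3 y 2 + (hexCriticalFugacity ^ 6 * y) • (eSerpThree * (1 + hatMZeroThree))) + hatMZeroThree * hatD 3 y 3 := by
    rw [Matrix.mul_add, Matrix.mul_one, smul_add, ← Matrix.smul_mul]
    calc hatD 3 y 3 = (hexCriticalFugacity ^ 6 * y) • eSerpThree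
          + (hatMZeroThree * hatD 3 y 3 + (hatMOneThree y * hatD 3 y 2 + (hexCriticalFugacity ^ 6 * y) • eSerpThree * hatMZeroThree)) := hren
      _ = _ := by abel
  rw [eq_one_add_hatMZero_mul h, Matrix.mul_add, ← Matrix.mul_assoc, ← gThree_eq, Matrix.mul_smul, ← Matrix.mul_assoc]

/-- ★★ `D̂(4) = G₃·D̂(3) + q·(E′·D̂(1))` (`E′ = (1 + M̂(0))(E₁₅ + E₄₀)`): the renewal equation at hat index `4` (`M̂(2) = M̂(4) = 0`, `M̂(3) = qE`).
[cite: Feller1968, XIII.3; DuminilCopinHammond2013, §2.2; lane «pcv-sawmu» a-p2 g28 — own] -/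
theorem hatD_three_four {y : ℝ} (hy : 0 ≤ y) :
    hatD 3 y 4 = gThree y * hatD 3 y 3 + (hexCriticalFugacity ^ 6 * y) • (ePrimeThree * hatD 3 y 1) := by
  obtain ⟨hM2, hM3, hM4⟩ := hatM_three_two_three_four y
  have hren := hat_ren (T := 3) hy 4
  rw [Finset.Nat.sum_antidiagonal_succ, Finset.Nat.sum_antidiagonal_succ, Finset.Nat.sum_antidiagonal_succ, Finset.Nat.sum_antidiagonal_succ,
    Finset.Nat.antidiagonal_zero, Finset.sum_singleton, hatM_three_zero, hatM_three_one, hM2, hM3, hM4] at hren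
  simp only [zero_add, Matrix.zero_mul, add_zero] at hren
  -- hren : D̂4 = M̂0·D̂4 + (M̂1·D̂3 + qE·D̂1)
  have h : hatD 3 y 4 = (hatMOneThree y * hatD 3 y 3 + (hexCriticalFugacity ^ 6 * y) • (eSerpThree * hatD 3 y 1)) + hatMZeroThree * hatD 3 y 4 := by
    rw [← Matrix.smul_mul]
    calc hatD 3 y 4 = hatMZeroThree * hatD 3 y 4 + (hatMOneThree y * hatD 3 y 3 + (hexCriticalFugacity ^ 6 * y) • eSerpThree * hatD 3 y 1) := hren
      _ = _ := by abel
  rw [eq_one_add_hatMZero_mul h, Matrix.mul_add, ← Matrix.mul_assoc, ← gThree_eq, Matrix.mul_smul, ← Matrix.mul_assoc, one_add_hatMZero_mul_eSerp]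

/-- ★ **The threshold of car 1's recursion is sharp**: at `k = 0` the order-four formula misses `D̂(4)` by exactly `−q·G₃`:
`D̂(4) = G₃D̂(3) + q(1+E′)D̂(1) − qG₃D̂(0) − q·G₃`. [cite: Feller1968, XIII.3; Stanley2012EC1, §4.1; lane «pcv-sawmu» a-p2 g28 — own] -/
theorem hatD_three_four_defect {y : ℝ} (hy : 0 ≤ y) :
    hatD 3 y 4 = gThree y * hatD 3 y 3 + (hexCriticalFugacity ^ 6 * y) • ((1 + ePrimeThree) * hatD 3 y 1)
      - (hexCriticalFugacity ^ 6 * y) • (gThree y * hatD 3 y 0) - (hexCriticalFugacity ^ 6 * y) • gThree y := by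
  rw [hatD_three_four hy, hatD_three_zero hy, hatD_three_one hy, Matrix.add_mul, Matrix.one_mul, smul_add, Matrix.mul_add, Matrix.mul_one, smul_add]
  abel

/-! ## §3 The initial values as powers of `G₃` -/

/-- ★ `D̂(2) = G₃²·(1 + M̂(0))`. [cite: Stanley2012EC1, §4.1 Theorem 4.1.1; lane «pcv-sawmu» a-p2 g28] -/
theorem hatD_three_two_pow {y : ℝ} (hy : 0 ≤ y) : hatD 3 y 2 = gThree y ^ 2 * (1 + hatMZeroThree) := by
  rw [hatD_three_two hy, hatD_three_one hy, pow_two, Matrix.mul_assoc]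

/-- ★ `D̂(3) = G₃³·(1 + M̂(0)) + q·(1 + M̂(0))(E₁₅ + E₄₀)(1 + M̂(0))`. [cite: Stanley2012EC1, §4.1 Theorem 4.1.1; lane «pcv-sawmu» a-p2 g28] -/
theorem hatD_three_three_pow {y : ℝ} (hy : 0 ≤ y) :
    hatD 3 y 3 = gThree y ^ 3 * (1 + hatMZeroThree) + (hexCriticalFugacity ^ 6 * y) • ((1 + hatMZeroThree) * eSerpThree * (1 + hatMZeroThree)) := by
  rw [hatD_three_three hy, hatD_three_two_pow hy]
  simp only [pow_two, pow_three, Matrix.mul_assoc]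

end W3

end HV

end Literature.Probability.RandomPlanarGeometry.SAW
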